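import Literature.Topology.FourManifolds.KhComplex
import Literature.Topology.FourManifolds.KhComplexQDegreeProofs
import Literature.Topology.FourManifolds.KhResolutionsCircleProofs
import Literature.Topology.FourManifolds.KhComplexFaceProofs
import Literature.Topology.FourManifolds.LeeRasmussenLabProofs
import HarnessLib

/-!
# Faces of the cube in Lee's basis anticommute (given the merge/split dichotomy)

Sibling file of `LeeRasmussen.lean` on the way to Lee's theorem `finrank_leeHomologyZero_eq_two`
(Lee (2005), Thm. 4.2). In the coordinates dual to Lee's basis `𝐚 = X + 1`, `𝐛 = X - 1` of
`ℚ[X]/(X² - 1)` (the rows of the transpose `Mᵀ` of the change-of-basis matrix `leeBasisMat` of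
`LeeRasmussenBasisProofs`; Lee's adjoint picture, Lee (2005), §4.4.2), the Lee differential sends
the coordinate `(σ, ℓ)` (`ℓ` a labelling of `σ` by `𝐚 ↔ false`, `𝐛 ↔ true`) to the sum over the
free `0`-smoothed chords `i` of `edgeSign σ i · leeCoef σ i ℓ · (σ[i ↦ 1], ℓ)`, where the **Lee
coefficient** is `±1` at a merge of two circles labelled `𝐚` / `𝐛` (from `m(𝐚,𝐚) = 2𝐚`,
`m(𝐛,𝐛) = -2𝐛`, `m(𝐚,𝐛) = 0`) and `2` at a split (from `Δ𝐚 = 𝐚 ⊗ 𝐚`, `Δ𝐛 = 𝐛 ⊗ 𝐛`). This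
file proves the purely combinatorial statements that make `d² = 0` and the contraction of the
free cubes work in these coordinates:

* (from `KhComplexFaceProofs`: `edgeSign_mul_edgeSign_update` — the Koszul signs of the two
  paths around a square face of the cube are opposite; Khovanov (2000), §3.3);
* `leeCoef_face` — **given the merge/split dichotomy** at the four edges of the face (the
  conclusion of the named fact `isMergeAt_or_isSplitAt_of_hasGaussDiagram` for diagrams of
  knots), the products of the Lee coefficients along the two paths agree: the numbers of merges
  agree by counting circles (`circleCount_eq_of_isMergeAt` / `…_of_isSplitAt` of
  `KhResolutionsCircleProofs`), and when the labels at the two chords differ, whether chord `i`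
  merges is not affected by the surgery at `j`, whose circles carry the other label
  (`isMergeAt_update_iff_of_label_ne`, by the locality lemma `reachable_or_near_of_agree`);
* `leeFace_eq_zero` — hence the signed face sum vanishes: this is `d² = 0` for Lee's complex in
  Lee's basis (Khovanov (2000), Prop. 8 / Lee (2005), §4: `(Φ + d)² = 0`), coefficientwise.

## References

* E. S. Lee, *An endomorphism of the Khovanov invariant*, Adv. Math. 197 (2005) 554–586, §4
  (the maps in the basis `𝐚`, `𝐛`; §4.4). [cite: Lee2005, §4]
* M. Khovanov, *A categorification of the Jones polynomial*, Duke Math. J. 101 (2000), §3.3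
  (signs on the cube), Prop. 8 (`d² = 0`). [cite: Khovanov2000, §3.3]
* D. Bar-Natan, Algebr. Geom. Topol. 2 (2002), §3.1–3.2. [cite: BarNatan2002, §3.2]
-/

open Function Set

noncomputable section

namespace Literature.Topology.FourManifolds

namespace GaussDiagram

variable {G : GaussDiagram}

/-! ## Lee coefficients -/

/-- The sign of Lee's basis vector under multiplication by itself: `𝐚² = 2𝐚`, `𝐛² = -2𝐛`
(`𝐚 ↔ false ↦ 1`, `𝐛 ↔ true ↦ -1`). Lee (2005), §4. [cite: Lee2005, §4] -/
def leeSign (t : Bool) : ℚ := if t then -1 else 1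

/-- `leeSign t` is `±1`. [folklore] -/
theorem leeSign_mul_self (t : Bool) : leeSign t * leeSign t = 1 := by
  cases t <;> simp [leeSign]

/-- `leeSign t ≠ 0`. [folklore] -/
theorem leeSign_ne_zero (t : Bool) : leeSign t ≠ 0 := by
  cases t <;> simp [leeSign]

/-- **The Lee coefficient** of the edge `σ → σ[i ↦ 1]` on the coordinate labelled `ℓ` (dual
Lee coordinates, `𝐚 ↔ false`, `𝐛 ↔ true`): `leeSign (ℓ A)` at a merge (the two merging circles
both carry the label `ℓ A` of `A = arcIn (overPos i)` when `i` is free; from `m(𝐚,𝐚) = 2𝐚`,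
`m(𝐛,𝐛) = -2𝐛`, `m(𝐚,𝐛) = 0` read in the rows of `Mᵀ`), `2` at a split (from `Δ𝐚 = 𝐚 ⊗ 𝐚`,
`Δ𝐛 = 𝐛 ⊗ 𝐛`), and `0` at a one-to-one bifurcation (the convention of `incidence` for virtual
diagrams). Lee (2005), §4, §4.4.2; Rasmussen (2010), §2.1. [cite: Lee2005, §4] -/
def leeCoef (σ : G.State) (i : Fin G.n) (ℓ : G.Arc → Bool) : ℚ :=
  if G.IsMergeAt σ i then leeSign (ℓ (G.arcIn (G.overPos i)))
  else if G.IsSplitAt σ i then 2 else 0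

/-- Under the merge/split dichotomy the Lee coefficient of an edge is nonzero. [folklore] -/
theorem leeCoef_ne_zero {σ : G.State} {i : Fin G.n} (h : G.IsMergeAt σ i ∨ G.IsSplitAt σ i)
    (ℓ : G.Arc → Bool) : G.leeCoef σ i ℓ ≠ 0 := by
  unfold leeCoef
  split_ifs with h1 h2
  · exact leeSign_ne_zero _
  · exact two_ne_zero
  · exact (h.elim h1 h2).elim

/-- The Lee coefficient as `leeSign^[merge] · 2^[split]` under the dichotomy. [folklore] -/
theorem leeCoef_eq {σ : G.State} {i : Fin G.n} (h : G.IsMergeAt σ i ∨ G.IsSplitAt σ i)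
    (ℓ : G.Arc → Bool) :
    G.leeCoef σ i ℓ = if G.IsMergeAt σ i then leeSign (ℓ (G.arcIn (G.overPos i))) else 2 := by
  unfold leeCoef
  split_ifs with h1 h2
  · rfl
  · rfl
  · exact (h.elim h1 h2).elim

/-! ## Whether an edge merges, seen from a neighbouring edge -/

/-- A merge is "the two local strands are not on one circle" (for a `0`-smoothed chord).
[folklore] -/
theorem isMergeAt_iff_not_reachable {σ : G.State} {i : Fin G.n} (hi : σ i = false) :
    G.IsMergeAt σ i ↔
      ¬ (G.stateGraph σ).Reachable (G.arcIn (G.overPos i)) (G.arcOut (G.overPos i)) := by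
  rw [IsMergeAt, Ne, circleOf_eq_iff]
  exact ⟨fun h ↦ h.2, fun h ↦ ⟨hi, h⟩⟩

/-- **Locality of merging across differently labelled chords.** Let `ℓ` be a labelling of both
`σ` and `σ[j ↦ 1]` (so `j` is free and the circles through the arcs at `j` carry the label
`ℓ (arcIn (overPos j))` before and after the flip), and let the arcs at chord `i` carry a
different label. Then whether the two local strands at `i` lie on one circle is the same before
and after the flip at `j`: a walk joining them never meets the circles operated on
(`reachable_or_near_of_agree`). Lee (2005), §4.4; Rasmussen (2010), §2.3. [folklore] -/
theorem reachable_update_iff_of_label_ne {σ : G.State} {ℓ : G.Arc → Bool} {i j : Fin G.n}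
    (hσ : G.IsLabelOf σ ℓ) (hσ' : G.IsLabelOf (Function.update σ j true) ℓ)
    (hfj : G.Free ℓ j) (hne : ℓ (G.arcIn (G.overPos i)) ≠ ℓ (G.arcIn (G.overPos j))) :
    (G.stateGraph (Function.update σ j true)).Reachable (G.arcIn (G.overPos i))
        (G.arcOut (G.overPos i)) ↔
      (G.stateGraph σ).Reachable (G.arcIn (G.overPos i)) (G.arcOut (G.overPos i)) := by
  have hB : ℓ (G.arcOut (G.overPos j)) = ℓ (G.arcIn (G.overPos j)) := hfj.1
  constructor
  · intro h
    rcases reachable_or_near_of_agree (σ := σ) (τ := Function.update σ j true) (i := j)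
      (fun k hk ↦ Function.update_of_ne hk _ _) h with h' | ⟨hx, -⟩
    · exact h'
    · exfalso
      rcases hx with hx | hx
      · exact hne (hσ.eq_of_reachable hx).symm
      · exact hne ((hσ.eq_of_reachable hx).symm.trans hB)
  · intro h
    rcases reachable_or_near_of_agree (σ := Function.update σ j true) (τ := σ) (i := j)
      (fun k hk ↦ (Function.update_of_ne hk _ _).symm) h with h' | ⟨hx, -⟩
    · exact h'
    · exfalso
      rcases hx with hx | hx
      · exact hne (hσ'.eq_of_reachable hx).symm
      · exact hne ((hσ'.eq_of_reachable hx).symm.trans hB)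

/-! ## The face identity -/

/-- **Lee coefficients commute around a face** (given the merge/split dichotomy at its four
edges). For `i ≠ j` both `0`-smoothed in `τ` and a labelling `ℓ` of `τ` free at `i` and at `j`:
`leeCoef τ i ℓ · leeCoef τ[i ↦ 1] j ℓ = leeCoef τ j ℓ · leeCoef τ[j ↦ 1] i ℓ`. Counting circles
along both paths, the numbers of merges agree; if the labels at `i` and `j` agree this settles
it, and if they differ each chord merges or not independently of the other flip
(`reachable_update_iff_of_label_ne`). This is the commutativity of the unsigned square faces of
the cube for Lee's TQFT restricted to one labelling (Khovanov (2000), §4.2, Prop. 8;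
Lee (2005), §4). [cite: Lee2005, §4] -/
theorem leeCoef_face {τ : G.State} {ℓ : G.Arc → Bool} {i j : Fin G.n} (hij : i ≠ j)
    (hi : τ i = false) (hj : τ j = false) (hℓ : G.IsLabelOf τ ℓ) (hfi : G.Free ℓ i)
    (hfj : G.Free ℓ j)
    (hD : ∀ (σ : G.State) (k : Fin G.n), σ k = false → G.IsMergeAt σ k ∨ G.IsSplitAt σ k) :
    G.leeCoef τ i ℓ * G.leeCoef (Function.update τ i true) j ℓ =
      G.leeCoef τ j ℓ * G.leeCoef (Function.update τ j true) i ℓ := by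
  have hi' : Function.update τ j true i = false := by rw [Function.update_of_ne hij, hi]
  have hj' : Function.update τ i true j = false := by rw [Function.update_of_ne hij.symm, hj]
  have hcomm : Function.update (Function.update τ i true) j true =
      Function.update (Function.update τ j true) i true := Function.update_comm hij _ _ _
  -- merge counts agree (count circles along both paths)
  have hcount : (if G.IsMergeAt τ i then 1 else 0) +
      (if G.IsMergeAt (Function.update τ i true) j then 1 else 0) =
      (if G.IsMergeAt τ j then 1 else 0) +
      (if G.IsMergeAt (Function.update τ j true) i then 1 else 0) := by
    have step : ∀ (σ : G.State) (k : Fin G.n), σ k = false →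
        G.circleCount (Function.update σ k true) + 2 * (if G.IsMergeAt σ k then 1 else 0) =
          G.circleCount σ + 1 := by
      intro σ k hk
      rcases hD σ k hk with h | h
      · rw [if_pos h]; have := circleCount_eq_of_isMergeAt h; omega
      · have hM : ¬ G.IsMergeAt σ k := fun hM ↦ IsMergeAt.not_isSplitAt_holds hM h
        rw [if_neg hM]; have := circleCount_eq_of_isSplitAt h; omega
    have h1 := step τ i hi
    have h2 := step _ j hj'
    have h3 := step τ j hj
    have h4 := step _ i hi'
    rw [hcomm] at h2
    omega
  have hℓi : G.IsLabelOf (Function.update τ i true) ℓ := (isLabelOf_update_iff hℓ (by simp [hi])).2 hfi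
  have hℓj : G.IsLabelOf (Function.update τ j true) ℓ := (isLabelOf_update_iff hℓ (by simp [hj])).2 hfj
  rw [leeCoef_eq (hD τ i hi), leeCoef_eq (hD _ j hj'), leeCoef_eq (hD τ j hj),
    leeCoef_eq (hD _ i hi')]
  by_cases ht : ℓ (G.arcIn (G.overPos i)) = ℓ (G.arcIn (G.overPos j))
  · -- same label: only the number of merges matters
    rw [ht]
    split_ifs at hcount ⊢ <;> first | (exfalso; omega) | rfl | ring
  · -- different labels: each chord merges independently of the other flip
    have h1 : G.IsMergeAt (Function.update τ j true) i ↔ G.IsMergeAt τ i := by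
      rw [isMergeAt_iff_not_reachable hi', isMergeAt_iff_not_reachable hi,
        reachable_update_iff_of_label_ne hℓ hℓj hfj ht]
    have h2 : G.IsMergeAt (Function.update τ i true) j ↔ G.IsMergeAt τ j := by
      rw [isMergeAt_iff_not_reachable hj', isMergeAt_iff_not_reachable hj,
        reachable_update_iff_of_label_ne hℓ hℓi hfi (Ne.symm ht)]
    by_cases hm1 : G.IsMergeAt τ i <;> by_cases hm2 : G.IsMergeAt τ j
    · rw [if_pos hm1, if_pos (h2.2 hm2), if_pos hm2, if_pos (h1.2 hm1)]; ring
    · rw [if_pos hm1, if_neg (fun h ↦ hm2 (h2.1 h)), if_neg hm2, if_pos (h1.2 hm1)]; ring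
    · rw [if_neg hm1, if_pos (h2.2 hm2), if_pos hm2, if_neg (fun h ↦ hm1 (h1.1 h))]; ring
    · rw [if_neg hm1, if_neg (fun h ↦ hm2 (h2.1 h)), if_neg hm2, if_neg (fun h ↦ hm1 (h1.1 h))]

/-- **The signed face sum vanishes** (Lee's `d² = 0` in Lee's basis, coefficientwise): for
`i ≠ j` both `0`-smoothed in `τ` and a labelling `ℓ` of `τ` free at `i` and `j`, given the
merge/split dichotomy,
`ε(τ,i) c_i(τ) ε(τ[i↦1],j) c_j(τ[i↦1]) + ε(τ,j) c_j(τ) ε(τ[j↦1],i) c_i(τ[j↦1]) = 0`.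
Khovanov (2000), Prop. 8; Lee (2005), §4 (`Φ + d` is a differential). [cite: Lee2005, §4] -/
theorem leeFace_eq_zero {τ : G.State} {ℓ : G.Arc → Bool} {i j : Fin G.n} (hij : i ≠ j)
    (hi : τ i = false) (hj : τ j = false) (hℓ : G.IsLabelOf τ ℓ) (hfi : G.Free ℓ i)
    (hfj : G.Free ℓ j)
    (hD : ∀ (σ : G.State) (k : Fin G.n), σ k = false → G.IsMergeAt σ k ∨ G.IsSplitAt σ k) :
    (edgeSign τ i : ℚ) * G.leeCoef τ i ℓ *
        ((edgeSign (Function.update τ i true) j : ℚ) * G.leeCoef (Function.update τ i true) j ℓ) +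
      (edgeSign τ j : ℚ) * G.leeCoef τ j ℓ *
        ((edgeSign (Function.update τ j true) i : ℚ) *
          G.leeCoef (Function.update τ j true) i ℓ) = 0 := by
  have hs := edgeSign_mul_edgeSign_update hij hi hj
  have hc := leeCoef_face hij hi hj hℓ hfi hfj hD
  have hs' : ((edgeSign τ i : ℤ) : ℚ) * (edgeSign (Function.update τ i true) j : ℚ) =
      -((edgeSign τ j : ℚ) * (edgeSign (Function.update τ j true) i : ℚ)) := by
    exact_mod_cast hs
  linear_combination (G.leeCoef τ j ℓ * G.leeCoef (Function.update τ j true) i ℓ) * hs' +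
    ((edgeSign τ i : ℚ) * (edgeSign (Function.update τ i true) j : ℚ)) * hc

end GaussDiagram

end Literature.Topology.FourManifolds
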